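import Literature.Barriers.AnomalousDissipation.ShearFlowViscositySelection
import Literature.Analysis.FluidPDE.TwoHalfWeakEuler
import Literature.Analysis.FluidPDE.TransportWeakExistence
import HarnessLib

/-!
# Bardos–Titi–Wiedemann 2012, Cor. 2 — proof architecture: Székelyhidi's vortex-sheet theorem
  (named fact), and the reduction of Cor. 2 to it and to the transport existence fact (proved)

Companion to `Literature/Barriers/AnomalousDissipation/ShearFlowViscositySelection.lean`, whose
named fact `BardosTitiWiedemann2012_cor2` (Bardos–Titi–Wiedemann, C. R. Math. Acad. Sci. Paris 350
(2012) 757–760, Cor. 2) asserts: for `v₀ = (v₁(x₂), 0, v₃(x₁,x₂))` with `v₁` the flat vortex-sheet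
profile and `v₃ ∈ L²(T²)` arbitrary, there are `T > 0` and infinitely many admissible weak Euler
solutions on `T³ × [0,T]` with datum `v₀`.

The printed proof (op. cit. §2): "Take `u(x,t) = (u₁(x₁,x₂,t), u₂(x₁,x₂,t))` to be a solution to
the 2D vortex sheet problem as in Theorem 1 [Székelyhidi, C. R. Math. 349 (2011), Thm. 1.1]. Then,
the triple `(u₁(x₁,x₂,t), u₂(x₁,x₂,t), w(x₁,x₂,t))` will be a weak solution of the 3D Euler
equations (with zero pressure and initial data `v₀`) if `w` is a weak solution of the 2D transport
equation `∂ₜw + u·∇w = 0`, `w(t=0) = v₃`. Such a solution `w ∈ L^∞((0,T);L²(T²))` exists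
[DiPerna–Lions, Prop. II.1] … we may even assume `w ∈ C((0,T);L²_w(T²))` [De Lellis–Székelyhidi
2010, App. A] … `‖w(·,t)‖_{L²} ≤ ‖v₃‖_{L²}` for every `t > 0` … Hence our solution `(u₁,u₂,w)` is
an admissible weak solution of the 3D Euler equations."

## This file

* `vortexSheetData` — Székelyhidi's two-dimensional vortex-sheet datum `(v₁(x₂), 0)` on `T²`
  (`v₁ = vortexSheetProfile`), with `shearData vortexSheetProfile v₃ = (vortexSheetData, v₃) ∘ π`
  (`shearData_vortexSheet_eq_twoHalf`) and `vortexSheetData ∈ L²` (`memLp_vortexSheetData`).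
* `Szekelyhidi2011_thm11` — **named fact**: Székelyhidi, C. R. Math. 349 (2011), Thm. 1.1 in the
  two-dimensional case, as restated in Bardos–Titi–Wiedemann 2012, Thm. 1: there are `T > 0` and
  infinitely many admissible weak Euler solutions on `T² × [0,T]` with datum `vortexSheetData`,
  bounded (`v ∈ L^∞(T² × (0,T))`), infinitely many of them conserving the energy and infinitely
  many with strictly decreasing energy. This is the convex-integration input (Székelyhidi 2011,
  Thm. 1.3 = De Lellis–Székelyhidi 2010, Prop. 2, applied to the explicit subsolution of op. cit.
  §2); it is not proved here (an `XL` item: the Baire-category / iterative construction with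
  localised plane waves, cf. the named fact `Literature.Analysis.FluidPDE.ConvexIntegration.ConvexIntegrationLemma2D`).
* `BardosTitiWiedemann2012_cor2_of_facts` — **proved**: Cor. 2 follows from
  `Szekelyhidi2011_thm11` and the transport existence fact
  `Torus.BardosTitiWiedemann2012_transportExistence (Fin 2)`
  (`Literature/Analysis/FluidPDE/TransportWeakExistence`), through the `2½`-dimensional lift
  theorem `Torus.isAdmissibleWeakEulerOn_twoHalf` (`Literature/Analysis/FluidPDE/TwoHalfWeakEuler`,
  the printed argument, proved). The discharge `BardosTitiWiedemann2012_cor2_holds` thus awaits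
  exactly these two facts.

## References

* C. Bardos, E. S. Titi, E. Wiedemann, C. R. Math. Acad. Sci. Paris 350 (2012) 757–760, Thm. 1,
  Cor. 2 and its proof (`BardosTitiWiedemann2012`).
* L. Székelyhidi Jr., C. R. Math. Acad. Sci. Paris 349 (2011) 1063–1066, Thm. 1.1, Thm. 1.3,
  Thm. 1.4, §2 (`Szekelyhidi2011`).
* C. De Lellis, L. Székelyhidi Jr., Arch. Ration. Mech. Anal. 195 (2010) 225–260, Prop. 2,
  Lemma 7.1 (`DeLellisSzekelyhidi2010`).
* R. J. DiPerna, P.-L. Lions, Invent. Math. 98 (1989) 511–547, Prop. II.1 (`DiPernaLions1989Invent`).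
-/

open MeasureTheory Set Filter Topology Function
open scoped ENNReal NNReal InnerProductSpace
open Literature.Analysis.FunctionSpaces.Torus (twoHalf planarProj planarProjE planarEmbed planarSect
  planarShear stLift IsWeaklyDivFree IsWeakNSSolutionWithDataOn measurePreserving_planarShear
  planarProj_planarShear planarProj_planarSect)
open Literature.Analysis.FluidPDE.Torus (IsAdmissibleWeakEulerOn IsWeakScalarTransportOn
  isAdmissibleWeakEulerOn_twoHalf BardosTitiWiedemann2012_transportExistence)

noncomputable section

namespace Literature.Barriers.AnomalousDissipation

/-- The flat three-torus `T³ = (ℝ/ℤ)³` (local notation). -/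
local notation "𝕋³" => UnitAddTorus (Fin 3)
/-- The flat two-torus `T² = (ℝ/ℤ)²` (local notation). -/
local notation "𝕋²" => UnitAddTorus (Fin 2)
/-- Velocity values (local notation). -/
local notation "E³" => EuclideanSpace ℝ (Fin 3)
/-- Planar velocity values (local notation). -/
local notation "E²" => EuclideanSpace ℝ (Fin 2)

/-! ## The two-dimensional vortex-sheet datum -/

/-- **Székelyhidi's vortex-sheet datum on `T²`**: `v₀(x) = (v₁(x₂), 0)` with `v₁ = 1` on
`(0, ½)` and `v₁ = -1` on `(-½, 0)` (Székelyhidi 2011, (1), `n = 2`; Bardos–Titi–Wiedemann 2012,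
(3) and Cor. 2), i.e. the planar part of `shearData vortexSheetProfile v₃`. [cite: Szekelyhidi2011, (1)] -/
def vortexSheetData : 𝕋² → E² :=
  fun y => !₂[vortexSheetProfile (y 1), 0]

/-- The planar projection of `x ∈ T³` in the coordinates of `shearData`. [folklore] -/
theorem planarProj_eq_vec (x : 𝕋³) : planarProj x = ![x 0, x 1] := by
  funext j
  fin_cases j <;> rfl

/-- **The shear datum with vortex-sheet profile is the `2½`-dimensional field of the planar
vortex-sheet datum and `v₃`**: `shearData v₁ v₃ = (vortexSheetData, v₃) ∘ π`. [folklore] -/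
theorem shearData_vortexSheet_eq_twoHalf (v₃ : 𝕋² → ℝ) :
    shearData vortexSheetProfile v₃ = twoHalf vortexSheetData v₃ := by
  funext x
  ext i
  fin_cases i
  · simp [shearData, twoHalf, vortexSheetData,
      Literature.Analysis.FunctionSpaces.Torus.planarEmbed_apply_zero]
  · simp [shearData, twoHalf, vortexSheetData,
      Literature.Analysis.FunctionSpaces.Torus.planarEmbed_apply_one]
  · simp [shearData, twoHalf, planarProj_eq_vec,
      Literature.Analysis.FunctionSpaces.Torus.planarEmbed_apply_two]

/-- The vortex-sheet profile is measurable (a measurable function on the fundamental interval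
transported by the measurable equivalence `AddCircle.measurableEquivIco`). [folklore] -/
theorem measurable_vortexSheetProfile : Measurable vortexSheetProfile := by
  unfold vortexSheetProfile AddCircle.liftIco
  refine Measurable.comp ?_ (AddCircle.measurableEquivIco (1 : ℝ) (-(1 / 2 : ℝ))).measurable
  exact (Measurable.ite measurableSet_Ioi measurable_const measurable_const).comp measurable_subtype_coe

/-- `|v₁| ≤ 1`. [folklore] -/
theorem abs_vortexSheetProfile_le (s : UnitAddCircle) : |vortexSheetProfile s| ≤ 1 := by
  unfold vortexSheetProfile AddCircle.liftIco
  simp only [Function.comp_apply, Set.restrict_apply]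
  split_ifs <;> simp

/-- The planar vortex-sheet datum is measurable. [folklore] -/
theorem measurable_vortexSheetData : Measurable vortexSheetData := by
  have h : vortexSheetData = (EuclideanSpace.equiv (Fin 2) ℝ).symm ∘
      fun y : 𝕋² => ![vortexSheetProfile (y 1), 0] := by
    funext y
    rfl
  rw [h]
  refine (EuclideanSpace.equiv (Fin 2) ℝ).symm.continuous.measurable.comp
    (measurable_pi_lambda _ fun i => ?_)
  fin_cases i
  · exact measurable_vortexSheetProfile.comp (measurable_pi_apply 1)
  · exact measurable_const

/-- `‖vortexSheetData y‖ ≤ 1`. [folklore] -/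
theorem norm_vortexSheetData_le (y : 𝕋²) : ‖vortexSheetData y‖ ≤ 1 := by
  rw [vortexSheetData, EuclideanSpace.norm_eq, Fin.sum_univ_two]
  simp only [Matrix.cons_val_zero, Matrix.cons_val_one, Real.norm_eq_abs,
    abs_zero, sq_abs]
  have h := abs_vortexSheetProfile_le (y 1)
  have h2 : vortexSheetProfile (y 1) ^ 2 ≤ 1 := by
    have := abs_le.1 h
    nlinarith [this.1, this.2]
  calc Real.sqrt (vortexSheetProfile (y 1) ^ 2 + (0 : ℝ) ^ 2) ≤ Real.sqrt 1 :=
        Real.sqrt_le_sqrt (by linarith)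
    _ = 1 := Real.sqrt_one

/-- **The planar vortex-sheet datum lies in `L²(T²)`** (bounded and measurable on a probability
space). [folklore] -/
theorem memLp_vortexSheetData : MemLp vortexSheetData 2 volume :=
  MemLp.of_bound measurable_vortexSheetData.aestronglyMeasurable 1
    (ae_of_all _ norm_vortexSheetData_le)

/-! ## Székelyhidi's theorem (named fact) -/

/-- **Infinitely many admissible weak Euler solutions with flat vortex-sheet datum**
(Székelyhidi, C. R. Math. 349 (2011), Thm. 1.1, case `n = 2`: "There exist infinitely many
admissible weak solutions `v ∈ L^∞(Tⁿ × (0,∞))` with initial data `v₀`. Infinitely many among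
these satisfy the energy equality, and infinitely many have strictly decreasing energy in time";
restated in Bardos–Titi–Wiedemann, C. R. Math. 350 (2012), Thm. 1: "There exist `T > 0` and
infinitely many weak solutions to the Euler equations in `T² × [0,T]` with initial data `v₀` and
pressure zero. Among these, infinitely many conserve the kinetic energy in time, and infinitely
many have strictly decreasing energy", a weak solution being a field in `C([0,T];L²_w(T²))`
solving Euler in the sense of distributions, admissible if `½∫|v(x,t)|² ≤ ½∫|v₀|²` for every
`t ∈ [0,T]`, op. cit. §1 (1)–(2)). Rendered on `T² = (ℝ/ℤ)²` for the datum `vortexSheetData`: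
there are `T > 0` and an infinite family `S` of fields, pairwise not a.e. equal on some time slice
of `[0,T]`, each an admissible weak Euler solution on `T² × [0,T]` with datum `vortexSheetData` in
the accepted sense `Torus.IsAdmissibleWeakEulerOn` (weak solution with datum, `C([0,T];L²_w)`,
`v(0) = v₀` a.e., weak energy inequality), with every slice `v(t)`, `t ∈ [0,T]`, in `L²` and
`v ∈ L^∞(T² × (0,T))` (`MemLp (stLift v) ∞` on `(0,T) × ℝ²`, as in the accepted
`Torus.exists_isWeakScalarTransportOn`); infinitely many members conserve the energy
(`∫|v(t)|² = ∫|v₀|²` on `[0,T]`) and infinitely many have strictly decreasing energy on `[0,T]`.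
The test class of the accepted weak formulation (divergence-free fields) is narrower than
"pressure zero" (all fields), so this rendering is implied by the printed statement. Not proved
here: the proof is convex integration (op. cit. Thm. 1.3–1.4 and §2; De Lellis–Székelyhidi 2010,
Prop. 2). [cite: Szekelyhidi2011, Thm. 1.1] [cite: BardosTitiWiedemann2012, Thm. 1] -/
def Szekelyhidi2011_thm11 : Prop :=
  ∃ T : ℝ, 0 < T ∧ ∃ S : Set (ℝ → 𝕋² → E²), S.Infinite ∧
    S.Pairwise (fun v v' => ¬ ∀ t ∈ Icc 0 T, v t =ᵐ[volume] v' t) ∧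
    (∀ v ∈ S, IsAdmissibleWeakEulerOn T vortexSheetData v ∧
      (∀ t ∈ Icc 0 T, MemLp (v t) 2 volume) ∧
      MemLp (stLift v) ∞ (volume.restrict (Ioo 0 T ×ˢ univ))) ∧
    {v ∈ S | ∀ t ∈ Icc 0 T, ∫⁻ x, ‖v t x‖ₑ ^ 2 = ∫⁻ x, ‖vortexSheetData x‖ₑ ^ 2}.Infinite ∧
    {v ∈ S | StrictAntiOn (fun t => ∫⁻ x, ‖v t x‖ₑ ^ 2) (Icc 0 T)}.Infinite

/-! ## Cor. 2 from the two facts -/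

/-- **Descent of a.e. equality of `2½`-dimensional fields to their planar parts**: if
`(V,R)∘π = (V',R')∘π` a.e. on `T³` then `V = V'` a.e. on `T²` (pull back along the
measure-preserving planar shear `T² × T¹ → T³` and apply Fubini). [folklore] -/
theorem ae_eq_of_twoHalf_ae_eq {V V' : 𝕋² → E²} {R R' : 𝕋² → ℝ}
    (h : twoHalf V R =ᵐ[volume] twoHalf V' R') : V =ᵐ[volume] V' := by
  have h1 := measurePreserving_planarShear.quasiMeasurePreserving.ae_eq_comp h
  have h2 : ∀ᵐ p : 𝕋² × UnitAddCircle ∂((volume : Measure 𝕋²).prod (volume : Measure UnitAddCircle)),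
      V p.1 = V' p.1 := by
    filter_upwards [h1] with p hp
    have hp' := congrArg planarProjE hp
    simpa [twoHalf, Literature.Analysis.FunctionSpaces.Torus.planarProjE_planarEmbed] using hp'
  have h3 := Measure.ae_ae_of_ae_prod h2
  filter_upwards [h3] with y hy
  exact hy.exists.choose_spec

/-- **Cor. 2 of Bardos–Titi–Wiedemann 2012 from Székelyhidi's theorem and the transport
existence fact** (the printed proof of Cor. 2, through the proved `2½`-dimensional lift
`Torus.isAdmissibleWeakEulerOn_twoHalf`): for every `v₃ ∈ L²(T²)`, the time `T > 0` and the
infinite family of planar solutions `u` of `Szekelyhidi2011_thm11` give, after transporting `v₃`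
by each `u` (`Torus.BardosTitiWiedemann2012_transportExistence (Fin 2)`), the infinite family
`(u, w) ∘ π` of admissible weak Euler solutions on `T³ × [0,T]` with datum
`shearData vortexSheetProfile v₃`; distinct `u` give lifts that are distinct on some time slice
(`ae_eq_of_twoHalf_ae_eq`). [cite: BardosTitiWiedemann2012, Cor. 2] -/
theorem BardosTitiWiedemann2012_cor2_of_facts (hS : Szekelyhidi2011_thm11)
    (hT : BardosTitiWiedemann2012_transportExistence (Fin 2)) : BardosTitiWiedemann2012_cor2 := by
  intro v₃ hv₃
  obtain ⟨T, hTpos, S, hSinf, hSpair, hSmem, -, -⟩ := hS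
  -- transport `v₃` by each member of the family
  have hW : ∀ v ∈ S, ∃ w : ℝ → 𝕋² → ℝ,
      IsWeakScalarTransportOn T 0 v v₃ w ∧
      (∀ t ∈ Icc 0 T, MemLp (w t) 2 volume) ∧
      (∀ t ∈ Icc 0 T, ∫⁻ x, ‖w t x‖ₑ ^ 2 ≤ ∫⁻ x, ‖v₃ x‖ₑ ^ 2) ∧
      (∀ g : 𝕋² → ℝ, MemLp g 2 volume → ContinuousOn (fun t => ∫ x, w t x * g x) (Icc 0 T)) ∧
      w 0 = v₃ := by
    intro v hv
    obtain ⟨hadm, -, hbdd⟩ := hSmem v hv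
    exact hT T hTpos v hbdd hadm.1.2.2.1 v₃ hv₃
  choose! W hW using hW
  -- the lifted family
  set L : (ℝ → 𝕋² → E²) → (ℝ → 𝕋³ → E³) := fun v t => twoHalf (v t) (W v t) with hL_def
  have hLinj : InjOn L S := by
    intro v hv v' hv' hvv'
    funext t y
    have h := congrFun (congrFun hvv' t) (planarSect y)
    have h' := congrArg planarProjE h
    simpa [hL_def, twoHalf, Literature.Analysis.FunctionSpaces.Torus.planarProjE_planarEmbed] using h'
  refine ⟨T, hTpos, L '' S, hSinf.image hLinj, ?_, ?_⟩
  · -- pairwise distinct on some slice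
    intro V₃ hV₃ V₃' hV₃' hne hall
    obtain ⟨v, hv, rfl⟩ := hV₃
    obtain ⟨v', hv', rfl⟩ := hV₃'
    have hvv' : v ≠ v' := fun h => hne (h ▸ rfl)
    exact hSpair hv hv' hvv' fun t ht => ae_eq_of_twoHalf_ae_eq (hall t ht)
  · -- each lift is admissible
    rintro V₃ ⟨v, hv, rfl⟩
    obtain ⟨hadm, hslice, -⟩ := hSmem v hv
    obtain ⟨hwsol, hw2, hwE, hwc, hw0⟩ := hW v hv
    have h := isAdmissibleWeakEulerOn_twoHalf memLp_vortexSheetData hv₃ hadm hslice hwsol hw2 hwE hwc hw0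
    rw [shearData_vortexSheet_eq_twoHalf]
    exact ⟨h.1, h.2.1, h.2.2.1, h.2.2.2⟩

end Literature.Barriers.AnomalousDissipation

end
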